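import Literature.AnabelianGeometry.SemiGraphs.TemperedCompactInVerticialCpt
import Literature.AnabelianGeometry.SemiGraphs.TreeSystemFixedPoint
import Literature.AnabelianGeometry.SemiGraphs.TemperedLevelData
import Mathlib.Order.Directed
import HarnessLib

/-!
# [SemiAnbd] Thm 3.7 (iii) beyond finite `𝔾`: level base points of a persistent vertex, and exhaustion of fixed branch pairs over one level pair

Mochizuki, *Semi-graphs of anabelioids*, Publ. RIMS **42** (2006), §3, Theorem 3.7 (iii), manuscript
p. 41, with the author's *Comments* (2020) (6)(b): "suppose that (∗_j) fails to hold. Then for each `i ≥ j`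
… there exists a pair of distinct edges `e_i, e'_i ∈ E_i` whose respective images … are distinct … forms a
subjoint … the subjoints … converge, in the profinite topology, to some profinite subjoint … a
contradiction, in light of our assumption that `𝒢` is totally estranged" [cite: MochizukiSemiAnbd2006, Thm 3.7(iii) p.41].

PROOF-ONLY (cell abc-iut, layer L3, row T37iii·LOCFIN-PERSIST (B3-L), L3-lead ruling α91; seat
abc-iut-w6-d066; no definition, no new named fact).  Print's convergence step needs the subjoints to range
over FINITELY many base subjoints ("Since the semi-graphs `𝔾_j` are all finite", p. 41); this file proves
the print mechanism LOCALISED AT ONE LEVEL PAIR, for the abstract level data `D : VerticialLevelData 𝒢 c`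
equipped with levels (`level`, immersions `quot`, `levelAct`, `levelTrans`, `levelProj`, finite fibres over
`𝔾`) and the compact-form branch-level identification (I4′)_cpt (`stabC`) of abc-iut-L3-t8/t11:

* `levelSystem_of_persistent` — a persistent base vertex `v` of `C` (some `C`-fixed tree vertex over `v`
  at every level) gives a COMPATIBLE system of level vertices over `v`, each under a `C`-fixed tree vertex
  (Kőnig on the finite level fibres over `v`);
* `finite_levelStar` — at a locally finite `𝔾` the level stars are finite;
* `eventually_no_unfolded_pair_over` — for a fixed level-`j` branch pair `(w₀; β₀ ≠ β₀')` and `C ≠ 1`,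
  only an initial segment of levels `k ≥ j` carries a `C`-fixed branch pair of the tree `𝒢_{∞,k}` whose
  image at level `j` is that pair (else Kőnig on the finite fibres over it yields a compatible `C`-fixed
  system of level branch pairs, killed by total estrangement through `stabC`:
  `noFixedBranchPairSystem_of_isTotallyEstranged_cpt`).

Consumers: `TemperedEdgeImagesOfPersistent.lean` (edge-sized images over a persistent vertex of a
locally finite `𝔾`).  Parallel (same sub-row, other route): abc-iut-L6-t17's uniform estrangement
`EstrangedUniform.lean`.  Nothing here bears on [IUTchIII] Cor. 3.12.
-/

namespace Literature.AnabelianGeometry.SemiGraphs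

namespace ProfiniteSemiGraph

namespace VerticialLevelData

open CategoryTheory Topology

universe v u

variable {𝒢 : ProfiniteSemiGraph.{u}} {c : TemperedPiChart 𝒢} (D : VerticialLevelData.{v} 𝒢 c)

section Levels

/-! ### The level structure (abstract): levels, immersions, actions, transitions, projections -/

variable (level : D.J → SemiGraph.{u}) (quot : ∀ j, D.tree j ⟶ level j)
  (levelAct : ∀ j, c.G →* Aut (level j))
  (levelTrans : ∀ ⦃i j : D.J⦄, i ≤ j → (level j ⟶ level i))
  (levelProj : ∀ j, level j ⟶ 𝒢.graph)

/-- **A persistent base vertex gives a compatible system of LEVEL vertices under fixed tree vertices**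
(Kőnig on the finite level fibres over `v`; print p. 41 "we may choose a compatible system").
[cite: MochizukiSemiAnbd2006, Thm 3.7(iii) p.41] -/
theorem levelSystem_of_persistent (C : Subgroup c.G)
    (trans_quot : ∀ ⦃i j : D.J⦄ (h : i ≤ j), D.trans h ≫ quot i = quot j ≫ levelTrans h)
    (levelTrans_id : ∀ j, levelTrans (le_refl j) = 𝟙 (level j))
    (levelTrans_comp : ∀ ⦃i j k : D.J⦄ (hij : i ≤ j) (hjk : j ≤ k),
      levelTrans hjk ≫ levelTrans hij = levelTrans (hij.trans hjk))
    (quot_proj : ∀ j, quot j ≫ levelProj j = D.proj j)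
    (levelTrans_proj : ∀ ⦃i j : D.J⦄ (h : i ≤ j), levelTrans h ≫ levelProj i = levelProj j)
    (finV : ∀ (j : D.J) (v : 𝒢.graph.Vertex), {w : (level j).Vertex | (levelProj j).vertexMap w = v}.Finite)
    (v : 𝒢.graph.Vertex)
    (hpers : ∀ j, ∃ x : (D.tree j).Vertex, (D.proj j).vertexMap x = v ∧
      ∀ g ∈ C, (D.act j g).hom.vertexMap x = x) :
    ∃ xbar : ∀ j, (level j).Vertex,
      (∀ ⦃i j : D.J⦄ (h : i ≤ j), (levelTrans h).vertexMap (xbar j) = xbar i) ∧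
      ∀ j, (levelProj j).vertexMap (xbar j) = v ∧
        ∃ x : (D.tree j).Vertex, (∀ g ∈ C, (D.act j g).hom.vertexMap x = x) ∧
          (quot j).vertexMap x = xbar j := by
  classical
  let F : ∀ j, Set (level j).Vertex := fun j =>
    {w | (levelProj j).vertexMap w = v ∧ ∃ x : (D.tree j).Vertex,
      (∀ g ∈ C, (D.act j g).hom.vertexMap x = x) ∧ (quot j).vertexMap x = w}
  obtain ⟨xbar, hF, hcompat⟩ := SemiGraph.exists_compatible_of_finite
    (fun i j (h : i ≤ j) => (levelTrans h).vertexMap)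
    (fun j w => by rw [levelTrans_id]; rfl)
    (fun i j k hij hjk w => by
      rw [← levelTrans_comp hij hjk, SemiGraph.comp_vertexMap, Function.comp_apply])
    F (fun j => (finV j v).subset fun w hw => hw.1)
    (fun j => by
      obtain ⟨x, hxv, hx⟩ := hpers j
      refine ⟨(quot j).vertexMap x, ?_, x, hx, rfl⟩
      have e := congrArg (fun ψ => SemiGraph.Hom.vertexMap ψ x) (quot_proj j)
      simp only [SemiGraph.comp_vertexMap, Function.comp_apply] at e
      rw [e, hxv])
    (by
      rintro i j h w ⟨hw, x, hx, rfl⟩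
      refine ⟨?_, (D.trans h).vertexMap x, fun g hg => ?_, ?_⟩
      · have e := congrArg (fun ψ => SemiGraph.Hom.vertexMap ψ ((quot j).vertexMap x)) (levelTrans_proj h)
        simp only [SemiGraph.comp_vertexMap, Function.comp_apply] at e
        rw [e, hw]
      · rw [← D.trans_act_vertexMap h g x, hx g hg]
      · have e := congrArg (fun ψ => SemiGraph.Hom.vertexMap ψ x) (trans_quot h)
        simpa only [SemiGraph.comp_vertexMap, Function.comp_apply] using e)
  exact ⟨xbar, hcompat, fun j => ⟨(hF j).1, (hF j).2⟩⟩


/-- Branches at a level vertex are finitely many when the base vertex below has finitely many branches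
and the level fibres over base branches are finite. [cite: MochizukiSemiAnbd2006, §1 p.13] -/
theorem finite_levelStar
    (finB : ∀ (j : D.J) (b : 𝒢.graph.Branch), {β : (level j).Branch | (levelProj j).branchMap β = b}.Finite)
    (hlf : ∀ v : 𝒢.graph.Vertex, {b : 𝒢.graph.Branch | 𝒢.graph.abuts b = some v}.Finite)
    (j : D.J) (w : (level j).Vertex) :
    {β : (level j).Branch | (level j).abuts β = some w}.Finite := by
  refine (((hlf ((levelProj j).vertexMap w)).biUnion fun b _ => finB j b)).subset ?_
  intro β hβ
  simp only [Set.mem_iUnion, Set.mem_setOf_eq, exists_prop]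
  exact ⟨(levelProj j).branchMap β, (levelProj j).abuts_branchMap β w hβ, rfl⟩

/-- **Only an initial segment of levels carries a fixed tree branch pair over a given level branch pair**
(print p. 41 ¶3 / Comments (2020) (6)(b), localised at one level-`j` branch pair `(w₀; β₀ ≠ β₀')`): for a
compact `C ≠ 1`, there is `k₀ ≥ j` such that for NO `k ≥ k₀` does the tree `𝒢_{∞,k}` contain two distinct
`C`-fixed branches at one `C`-fixed vertex whose images at level `j` are `β₀, β₀'` at `w₀`.  Otherwise such
pairs exist at every `k ≥ j` (push down along the transitions); their level-`k` images range over the FINITE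
fibre over `(w₀; β₀, β₀')`, so Kőnig gives a compatible system of `C`-fixed level branch pairs, which total
estrangement kills through (I4′)_cpt (`noFixedBranchPairSystem_of_isTotallyEstranged_cpt`).
[cite: MochizukiSemiAnbd2006, Thm 3.7(iii) p.41] -/
theorem eventually_no_unfolded_pair_over (h𝒢 : 𝒢.Thm37Hypotheses) (C : Subgroup c.G) (hC1 : C ≠ ⊥)
    (quot_isImmersion : ∀ j, SemiGraph.IsImmersion (quot j))
    (act_quot : ∀ (j : D.J) (g : c.G), (D.act j g).hom ≫ quot j = quot j ≫ (levelAct j g).hom)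
    (trans_quot : ∀ ⦃i j : D.J⦄ (h : i ≤ j), D.trans h ≫ quot i = quot j ≫ levelTrans h)
    (levelTrans_id : ∀ j, levelTrans (le_refl j) = 𝟙 (level j))
    (levelTrans_comp : ∀ ⦃i j k : D.J⦄ (hij : i ≤ j) (hjk : j ≤ k),
      levelTrans hjk ≫ levelTrans hij = levelTrans (hij.trans hjk))
    (levelTrans_proj : ∀ ⦃i j : D.J⦄ (h : i ≤ j), levelTrans h ≫ levelProj i = levelProj j)
    (finV : ∀ (j : D.J) (v : 𝒢.graph.Vertex), {w : (level j).Vertex | (levelProj j).vertexMap w = v}.Finite)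
    (finB : ∀ (j : D.J) (b : 𝒢.graph.Branch), {β : (level j).Branch | (levelProj j).branchMap β = b}.Finite)
    (stabC : ∀ (j₀ : D.J) (w : ∀ i : {i : D.J // j₀ ≤ i}, (level i.1).Vertex)
      (β β' : ∀ i : {i : D.J // j₀ ≤ i}, (level i.1).Branch),
      (∀ i, β i ≠ β' i ∧ (level i.1).abuts (β i) = some (w i) ∧ (level i.1).abuts (β' i) = some (w i)) →
      (∀ ⦃i i' : {i : D.J // j₀ ≤ i}⦄ (h : i.1 ≤ i'.1), (levelTrans h).vertexMap (w i') = w i ∧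
        (levelTrans h).branchMap (β i') = β i ∧ (levelTrans h).branchMap (β' i') = β' i) →
      ∃ (Q : Type u) (_ : Group Q) (ιQ : c.G →* Q) (v : 𝒢.graph.Vertex) (b b' : 𝒢.graph.Branch)
        (hb : 𝒢.graph.abuts b = some v) (hb' : 𝒢.graph.abuts b' = some v) (ψ : 𝒢.Gv v →* Q) (x x' : 𝒢.Gv v),
        Set.InjOn ιQ C ∧ Function.Injective ψ ∧ (b' ≠ b ∨ x⁻¹ * x' ∉ 𝒢.branchSubgroup b v hb) ∧
        ∀ g ∈ C, (∀ i, (levelAct i.1 g).hom.vertexMap (w i) = w i ∧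
          (levelAct i.1 g).hom.branchMap (β i) = β i ∧ (levelAct i.1 g).hom.branchMap (β' i) = β' i) →
          ιQ g ∈ ((𝒢.branchSubgroup b v hb).map (MulAut.conj x).toMonoidHom).map ψ ⊓
            ((𝒢.branchSubgroup b' v hb').map (MulAut.conj x').toMonoidHom).map ψ)
    (j : D.J) (w₀ : (level j).Vertex) (β₀ β₀' : (level j).Branch) (hβ : β₀ ≠ β₀') :
    ∃ (k₀ : D.J) (h₀ : j ≤ k₀), ∀ (k : D.J) (hk : k₀ ≤ k),
      ¬ ∃ (w : (D.tree k).Vertex) (cc cc' : (D.tree k).Branch), cc ≠ cc' ∧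
        (D.tree k).abuts cc = some w ∧ (D.tree k).abuts cc' = some w ∧
        (∀ g ∈ C, (D.act k g).hom.vertexMap w = w ∧ (D.act k g).hom.branchMap cc = cc ∧
          (D.act k g).hom.branchMap cc' = cc') ∧
        (levelTrans (h₀.trans hk)).vertexMap ((quot k).vertexMap w) = w₀ ∧
        (levelTrans (h₀.trans hk)).branchMap ((quot k).branchMap cc) = β₀ ∧
        (levelTrans (h₀.trans hk)).branchMap ((quot k).branchMap cc') = β₀' := by
  classical
  -- pointwise forms of the squares
  have tq_v : ∀ ⦃i k : D.J⦄ (h : i ≤ k) (x : (D.tree k).Vertex),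
      (quot i).vertexMap ((D.trans h).vertexMap x) = (levelTrans h).vertexMap ((quot k).vertexMap x) :=
    fun i k h x => by
      have e := congrArg (fun ψ => SemiGraph.Hom.vertexMap ψ x) (trans_quot h)
      simpa only [SemiGraph.comp_vertexMap, Function.comp_apply] using e
  have tq_b : ∀ ⦃i k : D.J⦄ (h : i ≤ k) (b : (D.tree k).Branch),
      (quot i).branchMap ((D.trans h).branchMap b) = (levelTrans h).branchMap ((quot k).branchMap b) :=
    fun i k h b => by
      have e := congrArg (fun ψ => SemiGraph.Hom.branchMap ψ b) (trans_quot h)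
      simpa only [SemiGraph.comp_branchMap, Function.comp_apply] using e
  have lt_v : ∀ ⦃i k l : D.J⦄ (hik : i ≤ k) (hkl : k ≤ l) (w : (level l).Vertex),
      (levelTrans hik).vertexMap ((levelTrans hkl).vertexMap w) = (levelTrans (hik.trans hkl)).vertexMap w :=
    fun i k l hik hkl w => by
      rw [← levelTrans_comp hik hkl, SemiGraph.comp_vertexMap, Function.comp_apply]
  have lt_b : ∀ ⦃i k l : D.J⦄ (hik : i ≤ k) (hkl : k ≤ l) (b : (level l).Branch),
      (levelTrans hik).branchMap ((levelTrans hkl).branchMap b) = (levelTrans (hik.trans hkl)).branchMap b :=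
    fun i k l hik hkl b => by
      rw [← levelTrans_comp hik hkl, SemiGraph.comp_branchMap, Function.comp_apply]
  have ta_b : ∀ ⦃i k : D.J⦄ (h : i ≤ k) (g : c.G) (b : (D.tree k).Branch),
      (D.trans h).branchMap ((D.act k g).hom.branchMap b) = (D.act i g).hom.branchMap ((D.trans h).branchMap b) :=
    fun i k h g b => by
      have e := congrArg (fun ψ => SemiGraph.Hom.branchMap ψ b) (D.trans_act h g)
      simpa only [SemiGraph.comp_branchMap, Function.comp_apply] using e
  have aq_v : ∀ (i : D.J) (g : c.G) (x : (D.tree i).Vertex),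
      (quot i).vertexMap ((D.act i g).hom.vertexMap x) = (levelAct i g).hom.vertexMap ((quot i).vertexMap x) :=
    fun i g x => by
      have e := congrArg (fun ψ => SemiGraph.Hom.vertexMap ψ x) (act_quot i g)
      simpa only [SemiGraph.comp_vertexMap, Function.comp_apply] using e
  have aq_b : ∀ (i : D.J) (g : c.G) (b : (D.tree i).Branch),
      (quot i).branchMap ((D.act i g).hom.branchMap b) = (levelAct i g).hom.branchMap ((quot i).branchMap b) :=
    fun i g b => by
      have e := congrArg (fun ψ => SemiGraph.Hom.branchMap ψ b) (act_quot i g)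
      simpa only [SemiGraph.comp_branchMap, Function.comp_apply] using e
  -- immersions do not fold pairs
  have imm : ∀ (i : D.J) (w : (D.tree i).Vertex) (cc cc' : (D.tree i).Branch), cc ≠ cc' →
      (D.tree i).abuts cc = some w → (D.tree i).abuts cc' = some w →
      (quot i).branchMap cc ≠ (quot i).branchMap cc' := by
    intro i w cc cc' hne hcc hcc' h
    have := quot_isImmersion i w (a₁ := ⟨cc, hcc⟩) (a₂ := ⟨cc', hcc'⟩) (Subtype.ext h)
    exact hne (congrArg Subtype.val this)
  -- TRANSPORT: a fixed tree pair at level `k'` over `τ` pushes down to one at level `k ≤ k'`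
  have transport : ∀ ⦃k k' : D.J⦄ (h : j ≤ k) (hkk' : k ≤ k') (w : (D.tree k').Vertex)
      (cc cc' : (D.tree k').Branch),
      (D.tree k').abuts cc = some w → (D.tree k').abuts cc' = some w →
      (∀ g ∈ C, (D.act k' g).hom.vertexMap w = w ∧ (D.act k' g).hom.branchMap cc = cc ∧
        (D.act k' g).hom.branchMap cc' = cc') →
      (levelTrans (h.trans hkk')).vertexMap ((quot k').vertexMap w) = w₀ →
      (levelTrans (h.trans hkk')).branchMap ((quot k').branchMap cc) = β₀ →
      (levelTrans (h.trans hkk')).branchMap ((quot k').branchMap cc') = β₀' →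
      (D.trans hkk').branchMap cc ≠ (D.trans hkk').branchMap cc' ∧
      (D.tree k).abuts ((D.trans hkk').branchMap cc) = some ((D.trans hkk').vertexMap w) ∧
      (D.tree k).abuts ((D.trans hkk').branchMap cc') = some ((D.trans hkk').vertexMap w) ∧
      (∀ g ∈ C, (D.act k g).hom.vertexMap ((D.trans hkk').vertexMap w) = (D.trans hkk').vertexMap w ∧
        (D.act k g).hom.branchMap ((D.trans hkk').branchMap cc) = (D.trans hkk').branchMap cc ∧
        (D.act k g).hom.branchMap ((D.trans hkk').branchMap cc') = (D.trans hkk').branchMap cc') ∧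
      (levelTrans h).vertexMap ((quot k).vertexMap ((D.trans hkk').vertexMap w)) = w₀ ∧
      (levelTrans h).branchMap ((quot k).branchMap ((D.trans hkk').branchMap cc)) = β₀ ∧
      (levelTrans h).branchMap ((quot k).branchMap ((D.trans hkk').branchMap cc')) = β₀' := by
    intro k k' h hkk' w cc cc' hcc hcc' hfix hw hb hb'
    have iw : (levelTrans h).vertexMap ((quot k).vertexMap ((D.trans hkk').vertexMap w)) = w₀ := by
      rw [tq_v hkk', lt_v h hkk', hw]
    have ib : (levelTrans h).branchMap ((quot k).branchMap ((D.trans hkk').branchMap cc)) = β₀ := by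
      rw [tq_b hkk', lt_b h hkk', hb]
    have ib' : (levelTrans h).branchMap ((quot k).branchMap ((D.trans hkk').branchMap cc')) = β₀' := by
      rw [tq_b hkk', lt_b h hkk', hb']
    refine ⟨fun heq => hβ ?_, (D.trans hkk').abuts_branchMap cc w hcc, (D.trans hkk').abuts_branchMap cc' w hcc',
      fun g hg => ⟨?_, ?_, ?_⟩, iw, ib, ib'⟩
    · rw [← ib, ← ib', heq]
    · rw [← D.trans_act_vertexMap hkk' g w, (hfix g hg).1]
    · rw [← ta_b hkk' g cc, (hfix g hg).2.1]
    · rw [← ta_b hkk' g cc', (hfix g hg).2.2]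
  -- suppose the contrary: bad pairs at cofinally many, hence all, levels `k ≥ j`
  by_contra hcon
  push Not at hcon
  have hall : ∀ (k : D.J) (h : j ≤ k), ∃ (w : (D.tree k).Vertex) (cc cc' : (D.tree k).Branch), cc ≠ cc' ∧
      (D.tree k).abuts cc = some w ∧ (D.tree k).abuts cc' = some w ∧
      (∀ g ∈ C, (D.act k g).hom.vertexMap w = w ∧ (D.act k g).hom.branchMap cc = cc ∧
        (D.act k g).hom.branchMap cc' = cc') ∧
      (levelTrans h).vertexMap ((quot k).vertexMap w) = w₀ ∧
      (levelTrans h).branchMap ((quot k).branchMap cc) = β₀ ∧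
      (levelTrans h).branchMap ((quot k).branchMap cc') = β₀' := by
    intro k h
    obtain ⟨k', hkk', w, cc, cc', -, hcc, hcc', hfix, hw, hb, hb'⟩ := hcon k h
    obtain ⟨hne, ha, ha', hf, iw, ib, ib'⟩ := transport h hkk' w cc cc' hcc hcc' hfix hw hb hb'
    exact ⟨_, _, _, hne, ha, ha', hf, iw, ib, ib'⟩
  -- Kőnig over the levels `≥ j` on triples (vertex, branch, branch) of the levels
  let J' := {k : D.J // j ≤ k}
  haveI : IsDirectedOrder J' := ⟨fun a b => by
    obtain ⟨m, ha, hb⟩ := exists_ge_ge a.1 b.1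
    exact ⟨⟨m, a.2.trans ha⟩, ha, hb⟩⟩
  haveI : Nonempty J' := ⟨⟨j, le_refl j⟩⟩
  let X : J' → Type u := fun k => (level k.1).Vertex × (level k.1).Branch × (level k.1).Branch
  let f : ∀ ⦃i k : J'⦄, i ≤ k → X k → X i := fun i k h t =>
    ((levelTrans h).vertexMap t.1, (levelTrans h).branchMap t.2.1, (levelTrans h).branchMap t.2.2)
  let F : ∀ k : J', Set (X k) := fun k =>
    {t | t.2.1 ≠ t.2.2 ∧ (level k.1).abuts t.2.1 = some t.1 ∧ (level k.1).abuts t.2.2 = some t.1 ∧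
      (∃ (w : (D.tree k.1).Vertex) (cc cc' : (D.tree k.1).Branch),
        (D.tree k.1).abuts cc = some w ∧ (D.tree k.1).abuts cc' = some w ∧
        (∀ g ∈ C, (D.act k.1 g).hom.vertexMap w = w ∧ (D.act k.1 g).hom.branchMap cc = cc ∧
          (D.act k.1 g).hom.branchMap cc' = cc') ∧
        (quot k.1).vertexMap w = t.1 ∧ (quot k.1).branchMap cc = t.2.1 ∧ (quot k.1).branchMap cc' = t.2.2) ∧
      (levelTrans k.2).vertexMap t.1 = w₀ ∧ (levelTrans k.2).branchMap t.2.1 = β₀ ∧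
      (levelTrans k.2).branchMap t.2.2 = β₀'}
  have lp_v : ∀ ⦃i k : D.J⦄ (h : i ≤ k) (w : (level k).Vertex),
      (levelProj i).vertexMap ((levelTrans h).vertexMap w) = (levelProj k).vertexMap w := fun i k h w => by
    have e := congrArg (fun ψ => SemiGraph.Hom.vertexMap ψ w) (levelTrans_proj h)
    simpa only [SemiGraph.comp_vertexMap, Function.comp_apply] using e
  have lp_b : ∀ ⦃i k : D.J⦄ (h : i ≤ k) (b : (level k).Branch),
      (levelProj i).branchMap ((levelTrans h).branchMap b) = (levelProj k).branchMap b := fun i k h b => by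
    have e := congrArg (fun ψ => SemiGraph.Hom.branchMap ψ b) (levelTrans_proj h)
    simpa only [SemiGraph.comp_branchMap, Function.comp_apply] using e
  obtain ⟨t, htF, htc⟩ := SemiGraph.exists_compatible_of_finite f
    (fun k t => by
      change ((levelTrans (le_refl k.1)).vertexMap t.1, (levelTrans (le_refl k.1)).branchMap t.2.1,
        (levelTrans (le_refl k.1)).branchMap t.2.2) = t
      rw [levelTrans_id]; rfl)
    (fun i k l hik hkl t => by
      change ((levelTrans hik).vertexMap ((levelTrans hkl).vertexMap t.1),
          (levelTrans hik).branchMap ((levelTrans hkl).branchMap t.2.1),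
          (levelTrans hik).branchMap ((levelTrans hkl).branchMap t.2.2)) =
        ((levelTrans (hik.trans hkl)).vertexMap t.1, (levelTrans (hik.trans hkl)).branchMap t.2.1,
          (levelTrans (hik.trans hkl)).branchMap t.2.2)
      rw [lt_v hik hkl, lt_b hik hkl, lt_b hik hkl])
    F
    (fun k => by
      -- finite: inside the fibre over the images of `(w₀; β₀, β₀')` in `𝔾`
      refine ((finV k.1 ((levelProj j).vertexMap w₀)).prod ((finB k.1 ((levelProj j).branchMap β₀)).prod
        (finB k.1 ((levelProj j).branchMap β₀')))).subset ?_
      rintro t ⟨-, -, -, -, hw, hb, hb'⟩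
      refine ⟨?_, ?_, ?_⟩
      · change (levelProj k.1).vertexMap t.1 = _
        rw [← lp_v k.2 t.1, hw]
      · change (levelProj k.1).branchMap t.2.1 = _
        rw [← lp_b k.2 t.2.1, hb]
      · change (levelProj k.1).branchMap t.2.2 = _
        rw [← lp_b k.2 t.2.2, hb'])
    (fun k => by
      obtain ⟨w, cc, cc', hne, hcc, hcc', hfix, hw, hb, hb'⟩ := hall k.1 k.2
      exact ⟨((quot k.1).vertexMap w, (quot k.1).branchMap cc, (quot k.1).branchMap cc'),
        imm k.1 w cc cc' hne hcc hcc', (quot k.1).abuts_branchMap cc w hcc, (quot k.1).abuts_branchMap cc' w hcc',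
        ⟨w, cc, cc', hcc, hcc', hfix, rfl, rfl, rfl⟩, hw, hb, hb'⟩)
    (by
      rintro i k hik ⟨t₁, t₂, t₃⟩ ⟨-, -, -, ⟨w, cc, cc', hcc, hcc', hfix, rfl, rfl, rfl⟩, hw, hb, hb'⟩
      have hw' : (levelTrans (i.2.trans hik)).vertexMap ((quot k.1).vertexMap w) = w₀ := by
        have : (i.2.trans hik : j ≤ k.1) = k.2 := rfl
        rw [this]; exact hw
      obtain ⟨hne, ha, ha', hf, iw, ib, ib'⟩ :=
        transport i.2 hik w cc cc' hcc hcc' hfix hw' hb hb'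
      refine ⟨?_, ?_, ?_, ⟨(D.trans hik).vertexMap w, (D.trans hik).branchMap cc, (D.trans hik).branchMap cc',
        ha, ha', hf, ?_, ?_, ?_⟩, ?_, ?_, ?_⟩
      · change (levelTrans hik).branchMap ((quot k.1).branchMap cc) ≠ (levelTrans hik).branchMap ((quot k.1).branchMap cc')
        rw [← tq_b hik, ← tq_b hik]
        exact imm i.1 _ _ _ hne ha ha'
      · change (level i.1).abuts ((levelTrans hik).branchMap ((quot k.1).branchMap cc)) =
          some ((levelTrans hik).vertexMap ((quot k.1).vertexMap w))
        rw [← tq_b hik, ← tq_v hik]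
        exact (quot i.1).abuts_branchMap _ _ ha
      · change (level i.1).abuts ((levelTrans hik).branchMap ((quot k.1).branchMap cc')) =
          some ((levelTrans hik).vertexMap ((quot k.1).vertexMap w))
        rw [← tq_b hik, ← tq_v hik]
        exact (quot i.1).abuts_branchMap _ _ ha'
      · exact tq_v hik w
      · exact tq_b hik cc
      · exact tq_b hik cc'
      · change (levelTrans i.2).vertexMap ((levelTrans hik).vertexMap ((quot k.1).vertexMap w)) = w₀
        rw [← tq_v hik]; exact iw
      · change (levelTrans i.2).branchMap ((levelTrans hik).branchMap ((quot k.1).branchMap cc)) = β₀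
        rw [← tq_b hik]; exact ib
      · change (levelTrans i.2).branchMap ((levelTrans hik).branchMap ((quot k.1).branchMap cc')) = β₀'
        rw [← tq_b hik]; exact ib')
  -- the compatible system of `C`-fixed level branch pairs, killed by total estrangement
  have hbot : C = ⊥ := by
    refine noFixedBranchPairSystem_of_isTotallyEstranged_cpt h𝒢 c level levelAct levelTrans C stabC j
      (fun k => (t k).1) (fun k => (t k).2.1) (fun k => (t k).2.2)
      (fun k => ⟨(htF k).1, (htF k).2.1, (htF k).2.2.1⟩) (fun i k h => ?_) (fun k γ => ?_)
    · have e := htc h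
      exact ⟨congrArg Prod.fst e, congrArg (fun t => t.2.1) e, congrArg (fun t => t.2.2) e⟩
    · obtain ⟨-, -, -, ⟨w, cc, cc', -, -, hfix, h1, h2, h3⟩, -⟩ := htF k
      refine ⟨?_, ?_, ?_⟩
      · rw [← h1, ← aq_v, (hfix γ γ.2).1]
      · rw [← h2, ← aq_b, (hfix γ γ.2).2.1]
      · rw [← h3, ← aq_b, (hfix γ γ.2).2.2]
  exact hC1 hbot


end Levels

end VerticialLevelData

end ProfiniteSemiGraph

end Literature.AnabelianGeometry.SemiGraphs

-- (olean rebuild trigger: stranded accept of p442556, 2026-08-26T12:2xZ; no content change)
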